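import Summits.BirchSwinnertonDyer.Rank1Residual.GaloisImage.KatoKuriharaValueGeneralLevelSockets
import Summits.BirchSwinnertonDyer.Rank1Residual.GaloisImage.KolyvaginParityProjection
import HarnessLib

/-!
# The general-level VALUE LAW of the route-1 PORT on the parity road, in THEOREM D's literal
# currency: `Λfin(loc_v (κ_r + κ_r)) = s mod p^{k+1}` and `Λfin(loc_v κ_r) = u · p^t · δ̃` for an
# ARBITRARY THEOREM-D output of Kato's Euler system (sub-target PK-6 general = ROUTE-1 §58 D-58-1 on
# R1-72 (B)'s road; cell `b2b-bsdres`, team n1011, seat p13 GEN 14 — PK-6 lineage; lead R5-110 (k))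

HONEST FRAMING (cell `b2b-bsdres`, run/shared/lean/b2b/bsd-rank1-residual/, verbatim in every
file): the goal of the cell is to DELETE the COMBINATION-SHAPED residual classes of the
Birch–Swinnerton-Dyer formula for ALL analytic-rank `≤ 1` elliptic curves over `ℚ` — "full BSD
formula for every rank `≤ 1` curve in class `C`" assembled STRICTLY from published theorems — so
that the rank-`≤ 1` remainder becomes exactly the CONSTRUCTION-SHAPED classes, which are TYPED
(missing-input `Prop`s), NOT attempted. This is not "finishing BSD". Team n1011 (N10/N11; ROUTE 1,
the PORT anatomy (P-KIM) of class X4 ∧ `p = 3`): research route on CONSTRUCTION-SHAPED classes;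
prove what is provable now; no claim beyond stated classes; census output = EVIDENCE, never a
Literature fact; RESIDUAL-MAP marks UNCHANGED; nothing is booked by this file.  TOOL THEOREMS ONLY:
no definition, no named fact, no instance, no `sorry`; Kato's `ZetaBody` and the (P-EXP) rider
`KatoExpStarFiniteLevelAt` (PK-5, CONSTRUCTION-SHAPED, never `_holds`) enter as DISPLAYED HYPOTHESES
`hbody` / `hfin`, never asserted; NO Euler-system axiom of `hbody` is consumed here beyond (C3a)/(C4)
(through n1011-p02's PK-1 ★2 / E-E by name); closes nothing on N11.

## What (lead R5-110 (k): "PK-6 general = (S1) + (S2) + §5 + 4b-C `hval`")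

For an ARBITRARY output `(σ, Φ, comm, κ)` of THEOREM D for Kato's Euler system `z` (n1011-p11 D4
`Derivative.Rat.exists_isKolyvaginSystem_propagatedSelmerStructure` / D6 / D7, literal currency:
`hΦ`, `hKS : D.IsKolyvaginSystem 𝓕_can κ`, the characterisation clause
`res_{U_r} κ_r = D_r (Φ_r (red_* z_{0,r}))` — ROUTE-1 §58 D-58-1: `σ` is a BINDER, not chosen here),
a coefficient system `(T′, red, e)` pinned by `e ∘ red = (a ↦ a_{k+1})` (D4/D7's `hcomp`; D6's is
`rfl`), the rider `hfin` at `v ∣ p`, a level `r ⊆ 𝒫` and a scalar `s ∈ ℤ_p`: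

* ★★ `apply_localization_add_self_eq_toZModPow_of_derivativeFamily` — IF the PLUS-SYMMETRISED field
  value satisfies `p^t · (1 ⊗ D^{field}_r (x_{0,r} + σ₋₁ x_{0,r})) − s ⊗ 1 ∈ p^{k+1} · L_int` (the OUT of
  n1011-p02's T-PK6-VAL `KatoKuriharaValueOfComparison` on n1011-p15's PK-4b-C, token-for-token the
  `hval` of T-PK-PAR §5 ★ `KatoParity.…_of_zetaBody_deriv`), THEN
  **`Λfin (loc_v (κ_r + κ_r)) = s mod p^{k+1}`**.  Proof = composition BY NAME: n1011-p11's T-PK6-D58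
  (S1) `KatoValue.GeneralLevel.resSubgroup_eq_comp_map_deriv` (the derivative moved inside
  `Ψ_r = Φ_r ∘ red_*`) + (S2) `localization_mem_of_isKolyvaginSystem` (clause (0) at `v`, `v ∉ r`
  because usable primes are `≠ p`) + n1011-p13's pin glue `KatoValue.comp_oneCocycleClass_eq_of_pin`
  (`Ψ_r` admissible for PK-5 (ii)) + T-PK-PAR §5 ★ (PK-5 (ii) at `(D^T_r z + g₋·D^T_r z, κ_r + κ_r)`
  with `ZetaBody` (C3a)/(C4) through E-E), the conjugation `g₋` (`χ_n(g₋) = −1`) OBTAINED INSIDE from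
  `KatoParity.exists_modNCyclotomicCharacter_eq_neg_one` — no generator datum, no hypothesis.
* ★ `exists_unit_apply_localization_add_self_eq_of_derivativeFamily` /
  ★ `exists_unit_apply_localization_eq_of_derivativeFamily` — with the unit reading of the scalar
  (T-PK6-VAL (V4): `s mod p^{k+1} = w · p^t · δ̃`, `w` a unit; DISPLAYED) the VALUE CLAUSE OF DICT3 AT THE
  LEVEL `r`: `Λfin (loc_v (κ_r + κ_r)) = w · p^t · δ̃` and, halving (`p` odd:
  `KatoParity.isUnit_two_zmod_pow`), **`∃ u ∈ (ℤ/p^{k+1})ˣ, Λfin (loc_v κ_r) = u · p^t · δ̃`** for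
  THEOREM D's OWN class `κ_r` — the shape `KatoKuriharaDictionaryThreeAt` / `KatoKuriharaWitnessAt`
  (DICT3) state, `δ̃` any element (intended `kuriharaNumber f (p^(k+1)) n ψ`).

What is displayed and what is NOT: displayed = `hbody` (witnesses bound, never obtained — §48.4
socket), `hfin`, the coefficient system, THEOREM D's output verbatim, `hvp`, `r ⊆ 𝒫`, `s`, `hval` (resp. `w`, `hw`) — the `T_pE`-side
commutation witness is n1011-p11's `pairwise_commute_tateDeriv`, supplied inside; NOT
here: the value witness `s` and its congruence (PK-4b-C, n1011-p15 lineage; T-PK6-VAL, n1011-p02), the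
two-depth (COMP) assembly ★ PK-6₂ (D7; its PORT′ target per lead R5-110 (n2)/(n3)), END-b, Kolyvagin
primes, any `_holds`.  General `p`, `k`, `t`; `v ∣ p`.  0 defs / 0 facts / 0 sorry.

References: K. Kato, Astérisque 295 (2004) §9.4, Thm. 9.7 [Kato2004Asterisque]; C.-H. Kim, AJM 148 =
arXiv:2203.12159, §3.4.1 and the proof of Thm. 3.13 (arXiv v3 pp. 26–27) [Kim2022StructureSelmer];
B. Mazur, K. Rubin, Mem. AMS 799 (2004), Thm. 3.2.4, App. A [MazurRubin2004]; K. Rubin, *Euler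
Systems* (2000), Def. 4.4.1, Def. 4.4.4 [Rubin2000]; design `cells/n1011/ROUTE-1.md` §56.3 (B) R1-72,
§58 D-58-1; lead R5-110 (k); `cells/n1011/skel/T-PORT-1-PKIM.md` v0.6 (20).
-/

noncomputable section

open scoped NumberField TensorProduct
open CategoryTheory Field Finset IsDedekindDomain NumberField WeierstrassCurve Rat.HeightOneSpectrum
open Literature.NumberTheory.GaloisRepresentations Literature.NumberTheory.GaloisCohomology
open Literature.NumberTheory.GaloisRepresentations.DiscreteGaloisModule
open Literature.NumberTheory.EllipticCurves Literature.NumberTheory.EllipticCurves.Kato2004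
open Literature.NumberTheory.EllipticCurves.Kato2004.EulerSystemValues

namespace Summit.BirchSwinnertonDyer.Rank1Residual.GaloisImage.KatoValue.GeneralLevel

variable (W : WeierstrassCurve ℚ) [W.IsElliptic] (p : ℕ) [Fact p.Prime]
  [ContinuousSMul ℤ_[p] (W.tateModule p)] [Module.Free ℤ_[p] (W.tateModule p)]
  [Module.Finite ℤ_[p] (W.tateModule p)] {N : ℕ} (f : CuspForm (CongruenceSubgroup.Gamma0 N) 2)
  (ι : (m : ℕ) → (CyclotomicField m ℚ →+* ℂ)) (κK : ℝ)
  (Λ : ∀ (k' : ℕ) (r : Finset (HeightOneSpectrum (𝓞 ℚ))),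
    H1 (tateRep W p) (cycSubgroup p k' r) →ₗ[ℤ_[p]] ℚ_[p] ⊗[ℚ] CyclotomicField (cycLevel p k' r) ℚ)
  (c d a : ℤ) (A : ℕ)
  (z : ∀ (k' : ℕ) (r : (cyclotomicLevelsRat p (badPlaces c d A N)).Ideals),
    H1 (tateRep W p) ((cyclotomicLevelsRat p (badPlaces c d A N)).level k' r.1))
  (x : ∀ (k' : ℕ) (r : (cyclotomicLevelsRat p (badPlaces c d A N)).Ideals),
    CyclotomicField (cycLevel p k' r.1) ℚ)

/-- Local notation: `𝓛` = the levels of Kato's Euler system for the auxiliary datum `(c, d, A)`: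
`ℚ(μ_{p^{i}·r})`, `r` prime to `2cdpAN` (`cyclotomicLevelsRat p (badPlaces c d A N)`). -/
local notation3 "𝓛" => cyclotomicLevelsRat p (badPlaces c d A N)

/-- Local notation: `𝐃⟦X, U, τ⟧ ℓ = ∑_{j < ℓ−1} j·(τ_ℓ)_*^j` on `H¹(U, X)` (THEOREM D's `ℤ`-spelling). -/
local notation3 (prettyPrint := false) "𝐃⟦" X ", " U ", " τ "⟧" =>
  fun ℓ : HeightOneSpectrum (𝓞 ℚ) =>
  ∑ j ∈ Finset.range (((primesEquiv ℓ : Nat.Primes) : ℕ) - 1),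
    (j : Module.End ℤ (continuousCohomology 1 (subgroupRep X U))) *
      (conjMap X U ((τ : HeightOneSpectrum (𝓞 ℚ) → absoluteGaloisGroup ℚ) ℓ) 1).hom.toLinearMap ^ j

/-- Local notation: `𝐃T⟦r, τ⟧ ℓ` = the same operator on `H¹(ℚ(μ_r), T_pE)` (PK-1's `ℤ_p`-spelling). -/
local notation3 (prettyPrint := false) "𝐃T⟦" r ", " τ "⟧" =>
  fun ℓ : HeightOneSpectrum (𝓞 ℚ) =>
  ∑ j ∈ Finset.range (((primesEquiv ℓ : Nat.Primes) : ℕ) - 1),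
    (j : Module.End ℤ_[p] (H1 (tateRep W p) (cycSubgroup p 0 r))) *
      (conjMap (tateRep W p).toTopRep (cycSubgroup p 0 r)
        ((τ : HeightOneSpectrum (𝓞 ℚ) → absoluteGaloisGroup ℚ) ℓ) 1).hom.toLinearMap ^ j

/-- Local notation: `𝐃F⟦r, τ⟧ ℓ` = the same operator on the level FIELD `ℚ(ζ_{m(0,r)})`, the
generator acting through `σ_{χ_m(τ_ℓ)}` (PK-1 ★2's field-side spelling). -/
local notation3 (prettyPrint := false) "𝐃F⟦" r ", " τ "⟧" =>
  fun ℓ : HeightOneSpectrum (𝓞 ℚ) =>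
  ∑ j ∈ Finset.range (((primesEquiv ℓ : Nat.Primes) : ℕ) - 1),
    (j : Module.End ℚ (CyclotomicField (cycLevel p 0 r) ℚ)) *
      (sigma (cycLevel p 0 r) (modNCyclotomicCharacter ℚ (cycLevel p 0 r)
          ((τ : HeightOneSpectrum (𝓞 ℚ) → absoluteGaloisGroup ℚ) ℓ)) :
        CyclotomicField (cycLevel p 0 r) ℚ →ₐ[ℚ] CyclotomicField (cycLevel p 0 r) ℚ).toLinearMap ^ j

/-- **★★ THE GENERAL-LEVEL VALUE LAW ON THE PARITY ROAD, THEOREM D's LITERAL CURRENCY (PK-6 general,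
D-58-1 + R1-72 (B)).**  Data: Kato's witnesses bound by `hbody`; the rider `hfin` at `v ∣ p`; a pinned
coefficient system `(T′, red, e)`; a datum `D` with `𝒫 ⊆ 𝓛.primes`; THEOREM D's output `(σ, Φ, comm, κ)`
for the Euler system `z` EXACTLY as displayed by D4/D6/D7 (`hΦ`, `hKS`, `hres`); a level `r ⊆ 𝒫`; a
scalar `s`.  IF
`p^t · (1 ⊗ D^{field}_r (x_{0,r} + σ₋₁ x_{0,r})) − s ⊗ 1 ∈ p^{k+1} · L_int` THEN
`Λfin (loc_v (κ_r + κ_r)) = s mod p^{k+1}`.  (S1) + (S2) + pin glue + T-PK-PAR §5, the conjugation with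
`χ_{m(0,r)} = −1` obtained inside. [cite: Kato2004Asterisque, §9.4 (p. 188) and Thm. 9.7 (p. 189)]
[cite: Kim2022StructureSelmer, §3.4.1 and the proof of Thm. 3.13 (arXiv v3 pp. 26–27; = Thm. 3.11 of AJM 148)]
[cite: MazurRubin2004, Thm. 3.2.4 and App. A] [cite: Rubin2000, Def. 4.4.4] -/
theorem apply_localization_add_self_eq_toZModPow_of_derivativeFamily
    (hbody : ZetaBody W p f ι κK Λ c d a A z x)
    {k t : ℕ} {v : HeightOneSpectrum (𝓞 ℚ)}
    {Λfin : galoisCohomology ((W.torsionGaloisModule ((p : ℤ) ^ k * (p : ℤ))).toLocal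
      (Sum.inr v)) 1 →+ ZMod (p ^ (k + 1))}
    (hfin : KatoExpStarFiniteLevelAt W p k t v Λ Λfin)
    {M' : Type} [AddCommGroup M'] [Module ℤ_[p] M'] [TopologicalSpace M'] [IsTopologicalAddGroup M']
    [ContinuousSMul ℤ_[p] M'] {T' : GaloisRep ℚ ℤ_[p] M'}
    (red : (tateRep W p).toTopRep ⟶ T'.toTopRep)
    (e : M' →+ geomTorsion W ((p : ℤ) ^ k * (p : ℤ))) (hec : Continuous e)
    (he : ∀ (g : absoluteGaloisGroup ℚ) (y : M'),
      e (T'.toTopRep.ρ g y) = (W.torsionGaloisModule ((p : ℤ) ^ k * (p : ℤ))).toTopRep.ρ g (e y))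
    (hpin : ∀ b : W.tateModule p,
      ((e (red.hom b) : geomTorsion W ((p : ℤ) ^ k * (p : ℤ))) : geomPoints W) =
        TateModule.proj p (k + 1) b)
    (D : KolyvaginDatum (W.torsionGaloisModule ((p : ℤ) ^ k * (p : ℤ))))
    (hPr : D.primes ⊆ (𝓛).primes)
    (σ : HeightOneSpectrum (𝓞 ℚ) → absoluteGaloisGroup ℚ)
    (Φ : ∀ r : Finset (HeightOneSpectrum (𝓞 ℚ)),
      continuousCohomology 1 (subgroupRep T'.toTopRep ((𝓛).level ⊥ r)) →+
        continuousCohomology 1 (subgroupRep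
          (W.torsionGaloisModule ((p : ℤ) ^ k * (p : ℤ))).toTopRep ((𝓛).level ⊥ r)))
    (comm : ∀ r : Finset (HeightOneSpectrum (𝓞 ℚ)),
      ((r : Finset _) : Set (HeightOneSpectrum (𝓞 ℚ))).Pairwise fun a' b' =>
        Commute (𝐃⟦(W.torsionGaloisModule ((p : ℤ) ^ k * (p : ℤ))).toTopRep, ((𝓛).level ⊥ r), σ⟧ a')
          (𝐃⟦(W.torsionGaloisModule ((p : ℤ) ^ k * (p : ℤ))).toTopRep, ((𝓛).level ⊥ r), σ⟧ b'))
    (κ : Finset (HeightOneSpectrum (𝓞 ℚ)) →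
      galoisCohomology (W.torsionGaloisModule ((p : ℤ) ^ k * (p : ℤ))) 1)
    (hΦ : ∀ r, ∀ (φ : contOneCocycles (subgroupRep T'.toTopRep ((𝓛).level ⊥ r)))
      (ψ : contOneCocycles (subgroupRep
        (W.torsionGaloisModule ((p : ℤ) ^ k * (p : ℤ))).toTopRep ((𝓛).level ⊥ r))),
      (∀ g, ψ.1 g = e (φ.1 g)) → Φ r (oneCocycleClass _ φ) = oneCocycleClass _ ψ)
    (hKS : D.IsKolyvaginSystem (propagatedSelmerStructure W p k) κ)
    (hres : ∀ (r : Finset (HeightOneSpectrum (𝓞 ℚ))) (hr : (↑r : Set _) ⊆ D.primes),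
      resSubgroup (W.torsionGaloisModule ((p : ℤ) ^ k * (p : ℤ))).toTopRep ((𝓛).level ⊥ r) 1 (κ r) =
        (r.noncommProd 𝐃⟦(W.torsionGaloisModule ((p : ℤ) ^ k * (p : ℤ))).toTopRep,
            ((𝓛).level ⊥ r), σ⟧ (comm r))
          (Φ r (ContinuousCohomology.map (ContinuousMonoidHom.id _)
            (X := subgroupRep (tateRep W p).toTopRep ((𝓛).level ⊥ r))
            (Y := subgroupRep T'.toTopRep ((𝓛).level ⊥ r))
            ((TopRep.resFunctor ((𝓛).level ⊥ r).subtype).map red) 1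
            (z ⊥ ⟨r, fun _ hq => hPr (hr (Finset.mem_coe.2 hq))⟩))))
    (hvp : ((primesEquiv v : Nat.Primes) : ℕ) = p)
    (r : Finset (HeightOneSpectrum (𝓞 ℚ))) (hr : (↑r : Set _) ⊆ D.primes) (s : ℤ_[p])
    (hval : ∃ l ∈ cycIntLattice p (cycLevel p 0 r),
      ((p : ℤ_[p]) ^ t) • ((1 : ℚ_[p]) ⊗ₜ[ℚ]
        ((r.noncommProd 𝐃F⟦r, σ⟧ (ZetaValue.pairwise_commute_fieldDeriv (cycLevel p 0 r)
            (fun ℓ => modNCyclotomicCharacter ℚ (cycLevel p 0 r) (σ ℓ))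
            (fun ℓ => ((primesEquiv ℓ : Nat.Primes) : ℕ) - 1) r))
          (x 0 ⟨r, fun _ hq => hPr (hr (Finset.mem_coe.2 hq))⟩ +
            sigma (cycLevel p 0 r) (-1) (x 0 ⟨r, fun _ hq => hPr (hr (Finset.mem_coe.2 hq))⟩)))) -
          ((s : ℚ_[p]) ⊗ₜ[ℚ] (1 : CyclotomicField (cycLevel p 0 r) ℚ)) =
        ((p : ℤ_[p]) ^ (k + 1)) • (l : ℚ_[p] ⊗[ℚ] CyclotomicField (cycLevel p 0 r) ℚ)) :
    Λfin (galoisCohomology.localization (W.torsionGaloisModule ((p : ℤ) ^ k * (p : ℤ)))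
        (Sum.inr v) 1 (κ r + κ r)) = PadicInt.toZModPow (k + 1) s := by
  -- usable primes are `≠ p`, so `v ∉ r`; clause (0) at `v` by (S2)
  have hvr : v ∉ r := fun hmem => (hPr (hr (Finset.mem_coe.2 hmem))).2 hvp
  have hloc := localization_mem_of_isKolyvaginSystem hKS hr hvr
  -- a conjugation of the level: `χ_{m(0,r)}(g) = −1` (no datum, no hypothesis)
  obtain ⟨g, hg⟩ := KatoParity.exists_modNCyclotomicCharacter_eq_neg_one (cycLevel p 0 r)
  -- `Ψ_r := Φ_r ∘ red_*`, admissible for PK-5 (ii) by the pin glue; `res κ_r = Ψ_r (D^T_r z_{0,r})` by (S1)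
  let Ψ : H1 (tateRep W p) (cycSubgroup p 0 r) →+
      continuousCohomology 1
        (subgroupRep (W.torsionGaloisModule ((p : ℤ) ^ k * (p : ℤ))).toTopRep (cycSubgroup p 0 r)) :=
    (Φ r).comp (ContinuousCohomology.map (ContinuousMonoidHom.id (cycSubgroup p 0 r))
        (X := subgroupRep (tateRep W p).toTopRep (cycSubgroup p 0 r))
        (Y := subgroupRep T'.toTopRep (cycSubgroup p 0 r))
        ((TopRep.resFunctor (cycSubgroup p 0 r).subtype).map red) 1).hom.toLinearMap.toAddMonoidHom
  exact KatoParity.apply_localization_add_self_eq_toZModPow_of_zetaBody_deriv hbody hfin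
    ⟨r, fun _ hq => hPr (hr (Finset.mem_coe.2 hq))⟩ Ψ
    (fun φ ψ h => comp_oneCocycleClass_eq_of_pin red e hpin (cycSubgroup p 0 r) (Φ r) (hΦ r) φ ψ h)
    σ (fun ℓ => ((primesEquiv ℓ : Nat.Primes) : ℕ) - 1) r
    (pairwise_commute_tateDeriv W p r σ (fun ℓ => ((primesEquiv ℓ : Nat.Primes) : ℕ) - 1) r) hg (κ r) s
    (resSubgroup_eq_comp_map_deriv red e hec he (cycSubgroup p 0 r) (Φ r) (hΦ r) σ
      (fun ℓ => ((primesEquiv ℓ : Nat.Primes) : ℕ) - 1) r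
      (pairwise_commute_tateDeriv W p r σ (fun ℓ => ((primesEquiv ℓ : Nat.Primes) : ℕ) - 1) r)
      (comm r) _ (κ r) (hres r hr))
    hloc hval

/-- **★ DICT3's VALUE CLAUSE at the level `r` for the DOUBLED family `κ + κ`** (the Kolyvagin system of
record on the parity road, `KatoParity.isKolyvaginSystem_add_self`): with the unit reading of the scalar
— `s mod p^{k+1} = w · p^t · δ̃`, `w ∈ (ℤ/p^{k+1})ˣ` (T-PK6-VAL (V4); DISPLAYED) —
`Λfin (loc_v (κ_r + κ_r)) = w · p^t · δ̃` (`δ̃` any element; intended `kuriharaNumber f (p^(k+1)) n ψ`).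
[cite: Kim2022StructureSelmer, §3.4.1 and the proof of Thm. 3.13 (arXiv v3 pp. 26–27; = Thm. 3.11 of AJM 148)]
[cite: Kato2004Asterisque, Thm. 9.7 (p. 189)] -/
theorem exists_unit_apply_localization_add_self_eq_of_derivativeFamily
    (hbody : ZetaBody W p f ι κK Λ c d a A z x)
    {k t : ℕ} {v : HeightOneSpectrum (𝓞 ℚ)}
    {Λfin : galoisCohomology ((W.torsionGaloisModule ((p : ℤ) ^ k * (p : ℤ))).toLocal
      (Sum.inr v)) 1 →+ ZMod (p ^ (k + 1))}
    (hfin : KatoExpStarFiniteLevelAt W p k t v Λ Λfin)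
    {M' : Type} [AddCommGroup M'] [Module ℤ_[p] M'] [TopologicalSpace M'] [IsTopologicalAddGroup M']
    [ContinuousSMul ℤ_[p] M'] {T' : GaloisRep ℚ ℤ_[p] M'}
    (red : (tateRep W p).toTopRep ⟶ T'.toTopRep)
    (e : M' →+ geomTorsion W ((p : ℤ) ^ k * (p : ℤ))) (hec : Continuous e)
    (he : ∀ (g : absoluteGaloisGroup ℚ) (y : M'),
      e (T'.toTopRep.ρ g y) = (W.torsionGaloisModule ((p : ℤ) ^ k * (p : ℤ))).toTopRep.ρ g (e y))
    (hpin : ∀ b : W.tateModule p,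
      ((e (red.hom b) : geomTorsion W ((p : ℤ) ^ k * (p : ℤ))) : geomPoints W) =
        TateModule.proj p (k + 1) b)
    (D : KolyvaginDatum (W.torsionGaloisModule ((p : ℤ) ^ k * (p : ℤ))))
    (hPr : D.primes ⊆ (𝓛).primes)
    (σ : HeightOneSpectrum (𝓞 ℚ) → absoluteGaloisGroup ℚ)
    (Φ : ∀ r : Finset (HeightOneSpectrum (𝓞 ℚ)),
      continuousCohomology 1 (subgroupRep T'.toTopRep ((𝓛).level ⊥ r)) →+
        continuousCohomology 1 (subgroupRep
          (W.torsionGaloisModule ((p : ℤ) ^ k * (p : ℤ))).toTopRep ((𝓛).level ⊥ r)))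
    (comm : ∀ r : Finset (HeightOneSpectrum (𝓞 ℚ)),
      ((r : Finset _) : Set (HeightOneSpectrum (𝓞 ℚ))).Pairwise fun a' b' =>
        Commute (𝐃⟦(W.torsionGaloisModule ((p : ℤ) ^ k * (p : ℤ))).toTopRep, ((𝓛).level ⊥ r), σ⟧ a')
          (𝐃⟦(W.torsionGaloisModule ((p : ℤ) ^ k * (p : ℤ))).toTopRep, ((𝓛).level ⊥ r), σ⟧ b'))
    (κ : Finset (HeightOneSpectrum (𝓞 ℚ)) →
      galoisCohomology (W.torsionGaloisModule ((p : ℤ) ^ k * (p : ℤ))) 1)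
    (hΦ : ∀ r, ∀ (φ : contOneCocycles (subgroupRep T'.toTopRep ((𝓛).level ⊥ r)))
      (ψ : contOneCocycles (subgroupRep
        (W.torsionGaloisModule ((p : ℤ) ^ k * (p : ℤ))).toTopRep ((𝓛).level ⊥ r))),
      (∀ g, ψ.1 g = e (φ.1 g)) → Φ r (oneCocycleClass _ φ) = oneCocycleClass _ ψ)
    (hKS : D.IsKolyvaginSystem (propagatedSelmerStructure W p k) κ)
    (hres : ∀ (r : Finset (HeightOneSpectrum (𝓞 ℚ))) (hr : (↑r : Set _) ⊆ D.primes),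
      resSubgroup (W.torsionGaloisModule ((p : ℤ) ^ k * (p : ℤ))).toTopRep ((𝓛).level ⊥ r) 1 (κ r) =
        (r.noncommProd 𝐃⟦(W.torsionGaloisModule ((p : ℤ) ^ k * (p : ℤ))).toTopRep,
            ((𝓛).level ⊥ r), σ⟧ (comm r))
          (Φ r (ContinuousCohomology.map (ContinuousMonoidHom.id _)
            (X := subgroupRep (tateRep W p).toTopRep ((𝓛).level ⊥ r))
            (Y := subgroupRep T'.toTopRep ((𝓛).level ⊥ r))
            ((TopRep.resFunctor ((𝓛).level ⊥ r).subtype).map red) 1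
            (z ⊥ ⟨r, fun _ hq => hPr (hr (Finset.mem_coe.2 hq))⟩))))
    (hvp : ((primesEquiv v : Nat.Primes) : ℕ) = p)
    (r : Finset (HeightOneSpectrum (𝓞 ℚ))) (hr : (↑r : Set _) ⊆ D.primes) (s : ℤ_[p])
    (hval : ∃ l ∈ cycIntLattice p (cycLevel p 0 r),
      ((p : ℤ_[p]) ^ t) • ((1 : ℚ_[p]) ⊗ₜ[ℚ]
        ((r.noncommProd 𝐃F⟦r, σ⟧ (ZetaValue.pairwise_commute_fieldDeriv (cycLevel p 0 r)
            (fun ℓ => modNCyclotomicCharacter ℚ (cycLevel p 0 r) (σ ℓ))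
            (fun ℓ => ((primesEquiv ℓ : Nat.Primes) : ℕ) - 1) r))
          (x 0 ⟨r, fun _ hq => hPr (hr (Finset.mem_coe.2 hq))⟩ +
            sigma (cycLevel p 0 r) (-1) (x 0 ⟨r, fun _ hq => hPr (hr (Finset.mem_coe.2 hq))⟩)))) -
          ((s : ℚ_[p]) ⊗ₜ[ℚ] (1 : CyclotomicField (cycLevel p 0 r) ℚ)) =
        ((p : ℤ_[p]) ^ (k + 1)) • (l : ℚ_[p] ⊗[ℚ] CyclotomicField (cycLevel p 0 r) ℚ))
    {δ : ZMod (p ^ (k + 1))} (w : (ZMod (p ^ (k + 1)))ˣ)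
    (hw : PadicInt.toZModPow (k + 1) s = (w : ZMod (p ^ (k + 1))) * (p : ZMod (p ^ (k + 1))) ^ t * δ) :
    Λfin (galoisCohomology.localization (W.torsionGaloisModule ((p : ℤ) ^ k * (p : ℤ)))
        (Sum.inr v) 1 (κ r + κ r)) = (w : ZMod (p ^ (k + 1))) * (p : ZMod (p ^ (k + 1))) ^ t * δ := by
  rw [← hw]
  exact apply_localization_add_self_eq_toZModPow_of_derivativeFamily W p f ι κK Λ c d a A z x hbody
    hfin red e hec he hpin D hPr σ Φ comm κ hΦ hKS hres hvp r hr s hval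

/-- **★ DICT3's VALUE CLAUSE at the level `r` for THEOREM D's OWN class `κ_r`** (`p` odd): from the
doubled clause, `Λfin (loc_v κ_r) = u · p^t · δ̃` with the unit `u = w/2`
(`KatoParity.isUnit_two_zmod_pow`) — the literal shape of `KatoKuriharaDictionaryThreeAt`'s (DICT3)
clause, for ANY THEOREM-D output, modulo the displayed value inputs `(s, hval, w, hw)`.
[cite: Kim2022StructureSelmer, §3.4.1 and the proof of Thm. 3.13 (arXiv v3 pp. 26–27; = Thm. 3.11 of AJM 148)]
[cite: Kato2004Asterisque, Thm. 9.7 (p. 189)] -/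
theorem exists_unit_apply_localization_eq_of_derivativeFamily (hp2 : p ≠ 2)
    (hbody : ZetaBody W p f ι κK Λ c d a A z x)
    {k t : ℕ} {v : HeightOneSpectrum (𝓞 ℚ)}
    {Λfin : galoisCohomology ((W.torsionGaloisModule ((p : ℤ) ^ k * (p : ℤ))).toLocal
      (Sum.inr v)) 1 →+ ZMod (p ^ (k + 1))}
    (hfin : KatoExpStarFiniteLevelAt W p k t v Λ Λfin)
    {M' : Type} [AddCommGroup M'] [Module ℤ_[p] M'] [TopologicalSpace M'] [IsTopologicalAddGroup M']
    [ContinuousSMul ℤ_[p] M'] {T' : GaloisRep ℚ ℤ_[p] M'}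
    (red : (tateRep W p).toTopRep ⟶ T'.toTopRep)
    (e : M' →+ geomTorsion W ((p : ℤ) ^ k * (p : ℤ))) (hec : Continuous e)
    (he : ∀ (g : absoluteGaloisGroup ℚ) (y : M'),
      e (T'.toTopRep.ρ g y) = (W.torsionGaloisModule ((p : ℤ) ^ k * (p : ℤ))).toTopRep.ρ g (e y))
    (hpin : ∀ b : W.tateModule p,
      ((e (red.hom b) : geomTorsion W ((p : ℤ) ^ k * (p : ℤ))) : geomPoints W) =
        TateModule.proj p (k + 1) b)
    (D : KolyvaginDatum (W.torsionGaloisModule ((p : ℤ) ^ k * (p : ℤ))))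
    (hPr : D.primes ⊆ (𝓛).primes)
    (σ : HeightOneSpectrum (𝓞 ℚ) → absoluteGaloisGroup ℚ)
    (Φ : ∀ r : Finset (HeightOneSpectrum (𝓞 ℚ)),
      continuousCohomology 1 (subgroupRep T'.toTopRep ((𝓛).level ⊥ r)) →+
        continuousCohomology 1 (subgroupRep
          (W.torsionGaloisModule ((p : ℤ) ^ k * (p : ℤ))).toTopRep ((𝓛).level ⊥ r)))
    (comm : ∀ r : Finset (HeightOneSpectrum (𝓞 ℚ)),
      ((r : Finset _) : Set (HeightOneSpectrum (𝓞 ℚ))).Pairwise fun a' b' =>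
        Commute (𝐃⟦(W.torsionGaloisModule ((p : ℤ) ^ k * (p : ℤ))).toTopRep, ((𝓛).level ⊥ r), σ⟧ a')
          (𝐃⟦(W.torsionGaloisModule ((p : ℤ) ^ k * (p : ℤ))).toTopRep, ((𝓛).level ⊥ r), σ⟧ b'))
    (κ : Finset (HeightOneSpectrum (𝓞 ℚ)) →
      galoisCohomology (W.torsionGaloisModule ((p : ℤ) ^ k * (p : ℤ))) 1)
    (hΦ : ∀ r, ∀ (φ : contOneCocycles (subgroupRep T'.toTopRep ((𝓛).level ⊥ r)))
      (ψ : contOneCocycles (subgroupRep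
        (W.torsionGaloisModule ((p : ℤ) ^ k * (p : ℤ))).toTopRep ((𝓛).level ⊥ r))),
      (∀ g, ψ.1 g = e (φ.1 g)) → Φ r (oneCocycleClass _ φ) = oneCocycleClass _ ψ)
    (hKS : D.IsKolyvaginSystem (propagatedSelmerStructure W p k) κ)
    (hres : ∀ (r : Finset (HeightOneSpectrum (𝓞 ℚ))) (hr : (↑r : Set _) ⊆ D.primes),
      resSubgroup (W.torsionGaloisModule ((p : ℤ) ^ k * (p : ℤ))).toTopRep ((𝓛).level ⊥ r) 1 (κ r) =
        (r.noncommProd 𝐃⟦(W.torsionGaloisModule ((p : ℤ) ^ k * (p : ℤ))).toTopRep,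
            ((𝓛).level ⊥ r), σ⟧ (comm r))
          (Φ r (ContinuousCohomology.map (ContinuousMonoidHom.id _)
            (X := subgroupRep (tateRep W p).toTopRep ((𝓛).level ⊥ r))
            (Y := subgroupRep T'.toTopRep ((𝓛).level ⊥ r))
            ((TopRep.resFunctor ((𝓛).level ⊥ r).subtype).map red) 1
            (z ⊥ ⟨r, fun _ hq => hPr (hr (Finset.mem_coe.2 hq))⟩))))
    (hvp : ((primesEquiv v : Nat.Primes) : ℕ) = p)
    (r : Finset (HeightOneSpectrum (𝓞 ℚ))) (hr : (↑r : Set _) ⊆ D.primes) (s : ℤ_[p])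
    (hval : ∃ l ∈ cycIntLattice p (cycLevel p 0 r),
      ((p : ℤ_[p]) ^ t) • ((1 : ℚ_[p]) ⊗ₜ[ℚ]
        ((r.noncommProd 𝐃F⟦r, σ⟧ (ZetaValue.pairwise_commute_fieldDeriv (cycLevel p 0 r)
            (fun ℓ => modNCyclotomicCharacter ℚ (cycLevel p 0 r) (σ ℓ))
            (fun ℓ => ((primesEquiv ℓ : Nat.Primes) : ℕ) - 1) r))
          (x 0 ⟨r, fun _ hq => hPr (hr (Finset.mem_coe.2 hq))⟩ +
            sigma (cycLevel p 0 r) (-1) (x 0 ⟨r, fun _ hq => hPr (hr (Finset.mem_coe.2 hq))⟩)))) -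
          ((s : ℚ_[p]) ⊗ₜ[ℚ] (1 : CyclotomicField (cycLevel p 0 r) ℚ)) =
        ((p : ℤ_[p]) ^ (k + 1)) • (l : ℚ_[p] ⊗[ℚ] CyclotomicField (cycLevel p 0 r) ℚ))
    {δ : ZMod (p ^ (k + 1))} (w : (ZMod (p ^ (k + 1)))ˣ)
    (hw : PadicInt.toZModPow (k + 1) s = (w : ZMod (p ^ (k + 1))) * (p : ZMod (p ^ (k + 1))) ^ t * δ) :
    ∃ u : (ZMod (p ^ (k + 1)))ˣ,
      Λfin (galoisCohomology.localization (W.torsionGaloisModule ((p : ℤ) ^ k * (p : ℤ)))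
          (Sum.inr v) 1 (κ r)) = (u : ZMod (p ^ (k + 1))) * (p : ZMod (p ^ (k + 1))) ^ t * δ := by
  have h2 := exists_unit_apply_localization_add_self_eq_of_derivativeFamily W p f ι κK Λ c d a A z x
    hbody hfin red e hec he hpin D hPr σ Φ comm κ hΦ hKS hres hvp r hr s hval w hw
  rw [map_add, map_add, ← two_mul] at h2
  refine ⟨(KatoParity.isUnit_two_zmod_pow hp2 k).unit⁻¹ * w, ?_⟩
  rw [Units.val_mul, mul_assoc, mul_assoc, ← mul_assoc (w : ZMod (p ^ (k + 1))), ← h2, ← mul_assoc,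
    IsUnit.val_inv_mul, one_mul]

end Summit.BirchSwinnertonDyer.Rank1Residual.GaloisImage.KatoValue.GeneralLevel

end
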